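import Summits.ValiantsHypothesis.ValiantsHypothesis.Theorems.DivisionGapDefs

/-!
# Crux `DivisionGap.PerDivisionHard` (stmt-ValiantsHypothesis-5065), line
`pair-descent-jss-endpoint` (v15) — stub `stub_uniqueTopSum`: sums of uniquely topped products

For a weight `w` on the `n × n` matrix variables and a finite sum of weighted products
`h = Σ_{t ∈ T} a_t · Π_{i ∈ I t} F t i` over `ℝ≥0`: if every factor `F t i` is topped by at most
ONE monomial (`(top_w (F t i)).support.card ≤ 1`), then the top `w`-component of `h` has at most
`|T|` monomials.

Proof (no cancellation over `ℝ≥0`).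
* The top support of a finite sum lies in the union of the top supports of its summands
  (`support_topComponent_finset_sum_subset`): a monomial `d` of `top_w (Σ g)` has
  `weight d = deg_w (Σ g)` and a nonzero coefficient in some summand `g t`; over `ℝ≥0` the support
  of `g t` lies in the support of the sum, so `deg_w (g t) ≤ deg_w (Σ g) = weight d ≤ deg_w (g t)`.
* `top_w (a • p) = a • top_w p` and `top_w` is multiplicative (`topComponent_mul`), hence
  `top_w (Π F t i) = Π top_w (F t i)`.
* A product of polynomials with at most one monomial each has at most one monomial
  (`supp (p q) ⊆ supp p + supp q`, `Finset.card_add_le`).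
* Count: `card (T.biUnion _) ≤ Σ_{t ∈ T} 1 = |T|` (`Finset.card_biUnion_le`). [folklore]
-/

noncomputable section

-- `Summit.ValiantsHypothesis.ValiantsHypothesis.…` is the tree's mandated single-conjunct layout
-- (Sub = Summit), so the duplicated namespace component is intended.
set_option linter.dupNamespace false

namespace Summit.ValiantsHypothesis.ValiantsHypothesis.Theorems.DivisionGapPerDivisionHard

open MvPolynomial
open Summit.ValiantsHypothesis.ValiantsHypothesis.Theorems.ZeroOneTransfer.Negative
open scoped NNReal Pointwise

section TopSupport

variable {σ : Type*} (w : σ → ℕ)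

/-- Over `ℝ≥0` (no cancellation) every summand of a finite sum has its support inside the
support of the sum. [folklore] -/
private theorem support_term_subset_support_finset_sum {κ : Type*} (T : Finset κ)
    (g : κ → MvPolynomial σ ℝ≥0) {t : κ} (ht : t ∈ T) :
    (g t).support ⊆ (∑ s ∈ T, g s).support := by
  intro e he
  rw [mem_support_iff, coeff_sum]
  exact fun h0 => (mem_support_iff.mp he)
    ((Finset.sum_eq_zero_iff_of_nonneg fun _ _ => zero_le).mp h0 t ht)

/-- Over `ℝ≥0` the weighted degree of a summand is at most that of the finite sum. [folklore] -/
private theorem weightedTotalDegree_term_le_finset_sum {κ : Type*} (T : Finset κ)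
    (g : κ → MvPolynomial σ ℝ≥0) {t : κ} (ht : t ∈ T) :
    weightedTotalDegree w (g t) ≤ weightedTotalDegree w (∑ s ∈ T, g s) :=
  Finset.sup_le fun _ hd =>
    le_weightedTotalDegree w (support_term_subset_support_finset_sum T g ht hd)

/-- **The top support of a finite sum over `ℝ≥0` lies in the union of the top supports of its
summands.** [folklore] -/
private theorem support_topComponent_finset_sum_subset [DecidableEq σ] {κ : Type*}
    (T : Finset κ) (g : κ → MvPolynomial σ ℝ≥0) :
    (topComponent w (∑ t ∈ T, g t)).support ⊆
      T.biUnion fun t => (topComponent w (g t)).support := by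
  intro d hd
  have hd' := mem_support_iff.mp hd
  rw [coeff_topComponent] at hd'
  split_ifs at hd' with hwd
  · rw [coeff_sum] at hd'
    obtain ⟨t, ht, hne⟩ := Finset.exists_ne_zero_of_sum_ne_zero hd'
    refine Finset.mem_biUnion.mpr ⟨t, ht, ?_⟩
    rw [mem_support_iff, coeff_topComponent, if_pos]
    · exact hne
    · exact le_antisymm (le_weightedTotalDegree w (mem_support_iff.mpr hne))
        ((weightedTotalDegree_term_le_finset_sum w T g ht).trans hwd.ge)
  · exact absurd rfl hd'

/-- Over `ℝ≥0`: `top_w (a • p) = a • top_w p` (`a • p = C a * p`, `topComponent_mul`,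
`topComponent_C`). [folklore] -/
private theorem topComponent_smul (a : ℝ≥0) (p : MvPolynomial σ ℝ≥0) :
    topComponent w (a • p) = a • topComponent w p := by
  rw [smul_eq_C_mul, topComponent_mul, topComponent_C, smul_eq_C_mul]

-- adapted from `topComponent_finset_prod`
-- (Theorems/DivisionGapPerDivisionHardStubTorusFamily.lean), restated privately to keep this
-- file's imports at `DivisionGapDefs`.
/-- Top components are multiplicative over `ℝ≥0`, `Finset.prod` form:
`top_w (∏_{j ∈ s} f j) = ∏_{j ∈ s} top_w (f j)` (`topComponent_mul`, `topComponent_one`).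
[folklore] -/
private theorem topComponent_finset_prod_eq {ι : Type*} (s : Finset ι)
    (f : ι → MvPolynomial σ ℝ≥0) :
    topComponent w (∏ j ∈ s, f j) = ∏ j ∈ s, topComponent w (f j) :=
  Finset.prod_hom_rel (r := fun b c => topComponent w b = c) (topComponent_one w)
    fun a b c hbc => by rw [topComponent_mul, hbc]

/-- A finite product of polynomials with at most one monomial each has at most one monomial
(`supp (p * q) ⊆ supp p + supp q`). [folklore] -/
private theorem card_support_finset_prod_le_one {ι : Type*} (s : Finset ι)
    (g : ι → MvPolynomial σ ℝ≥0) (h : ∀ i ∈ s, (g i).support.card ≤ 1) :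
    (∏ i ∈ s, g i).support.card ≤ 1 := by
  classical
  induction s using Finset.induction_on with
  | empty => simp
  | insert i s hi ih =>
    rw [Finset.prod_insert hi]
    calc ((g i) * ∏ j ∈ s, g j).support.card
        ≤ ((g i).support + (∏ j ∈ s, g j).support).card :=
          Finset.card_le_card (support_mul _ _)
      _ ≤ (g i).support.card * (∏ j ∈ s, g j).support.card := Finset.card_add_le
      _ ≤ 1 * 1 := Nat.mul_le_mul (h i (Finset.mem_insert_self i s))
          (ih fun j hj => h j (Finset.mem_insert_of_mem hj))
      _ = 1 := rfl

end TopSupport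

/-- **stub_uniqueTopSum.**  If every factor `F t i` of every term is topped by at most ONE
monomial under `w`, then `top_w (Σ_{t∈T} a_t · Π_{i∈I t} F t i)` has at most `|T|` monomials: the
top support of a sum lies in the union of the top supports of its summands (coefficients over
`ℝ≥0`, maximal weight), `top_w` is multiplicative (`topComponent_mul`), and a product of
polynomials with `≤ 1` monomial each has `≤ 1` monomial. [folklore] -/
theorem stub_uniqueTopSum :
    ∀ (n : ℕ) (ι κ : Type) (T : Finset κ) (I : κ → Finset ι)
      (F : κ → ι → MvPolynomial (Fin n × Fin n) ℝ≥0) (a : κ → ℝ≥0) (w : Fin n × Fin n → ℕ),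
      (∀ t ∈ T, ∀ i ∈ I t, (topComponent w (F t i)).support.card ≤ 1) →
      (topComponent w (∑ t ∈ T, a t • ∏ i ∈ I t, F t i)).support.card ≤ T.card := by
  classical
  intro n ι κ T I F a w h
  calc (topComponent w (∑ t ∈ T, a t • ∏ i ∈ I t, F t i)).support.card
      ≤ (T.biUnion fun t => (topComponent w (a t • ∏ i ∈ I t, F t i)).support).card :=
        Finset.card_le_card (support_topComponent_finset_sum_subset w T _)
    _ ≤ ∑ t ∈ T, (topComponent w (a t • ∏ i ∈ I t, F t i)).support.card :=
        Finset.card_biUnion_le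
    _ ≤ ∑ _t ∈ T, 1 := Finset.sum_le_sum fun t ht => ?_
    _ = T.card := (Finset.card_eq_sum_ones T).symm
  rw [topComponent_smul, topComponent_finset_prod_eq]
  calc (a t • ∏ i ∈ I t, topComponent w (F t i)).support.card
      ≤ (∏ i ∈ I t, topComponent w (F t i)).support.card := Finset.card_le_card support_smul
    _ ≤ 1 := card_support_finset_prod_le_one (I t) _ fun i hi => h t ht i hi

end Summit.ValiantsHypothesis.ValiantsHypothesis.Theorems.DivisionGapPerDivisionHard

end
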